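import Mathlib
import HarnessLib
import Summits.Parity.BatemanHorn.Theorems.IsogenyRedeiSplitBlockJacobiRootWeylSumCRT

/-!
# Crux `SplitBlockJacobi` (stmt-Parity-11583, route `IsogenyRedei`), line `Ideate4Sketch`
# (card `salie-twist-absorption`): stub A — twist absorption

For distinct primes `Q ≡ Q' ≡ 1 (mod 4)`, CRT inverses `Q'u₂ ≡ 1 (mod Q)`, `Qu₁ ≡ 1 (mod Q')`
and `gcd(h, Q) = 1`,

  `(Q|Q') · S(h, QQ') = (h|Q) · ((hu₂|Q) · S(hu₂, Q)) · S(hu₁, Q')`,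

where `S(h, q) = Σ_{ν mod q, ν² ≡ -1 (q)} e(hν/q)` is the skeleton's `rootWeylSum h q` (body
expanded, as registered).  Proof: the CRT factorisation `S(h, QQ') = S(hu₂, Q) · S(hu₁, Q')`
(tree: `CofactorRootDiscrepancy.rootWeylSum_mul_of_coprime`) and the integer identity
`(Q|Q') = (h|Q) · (hu₂|Q)`, which follows from `(h|Q)² = 1`, `(u₂|Q) = (Q'|Q)` (because
`Q'u₂ ≡ 1 (mod Q)` and `(Q'|Q)² = 1`) and quadratic reciprocity for `Q ≡ Q' ≡ 1 (mod 4)`.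
-/

namespace Summit.Parity.BatemanHorn.Cruxes.SplitBlockJacobi.SalieTwistAbsorption

open Summit.Parity.BatemanHorn.Cruxes.SplitBlockJacobi.CofactorRootDiscrepancy

/-- `(u|Q) = (Q'|Q)` when `Q'u ≡ 1 (mod Q)` for distinct primes `Q, Q'`: the Jacobi symbol of an
inverse equals the symbol of the element, since `(Q'|Q)·(u|Q) = (Q'u|Q) = (1|Q) = 1` and
`(Q'|Q) ∈ {±1}`. [folklore] -/
theorem jacobiSym_natCast_eq_of_mul_modEq_one {Q Q' u : ℕ} (hQ : Q.Prime) (hQ' : Q'.Prime)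
    (hne : Q ≠ Q') (hu : Q' * u ≡ 1 [MOD Q]) : jacobiSym (u : ℤ) Q = jacobiSym (Q' : ℤ) Q := by
  have hprod : jacobiSym (Q' : ℤ) Q * jacobiSym (u : ℤ) Q = 1 := by
    have hmod : (Q' : ℤ) * (u : ℤ) % (Q : ℤ) = 1 % (Q : ℤ) := by
      have h1 : ((Q' * u : ℕ) : ℤ) ≡ ((1 : ℕ) : ℤ) [ZMOD (Q : ℤ)] := Int.natCast_modEq_iff.mpr hu
      unfold Int.ModEq at h1
      push_cast at h1
      exact h1
    rw [← jacobiSym.mul_left, jacobiSym.mod_left' hmod, jacobiSym.one_left]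
  have hgcd : (Q' : ℤ).gcd Q = 1 := by
    rw [Int.gcd_natCast_natCast]
    exact (Nat.coprime_primes hQ' hQ).mpr hne.symm
  calc jacobiSym (u : ℤ) Q = jacobiSym (Q' : ℤ) Q ^ 2 * jacobiSym (u : ℤ) Q := by
        rw [jacobiSym.sq_one hgcd, one_mul]
    _ = jacobiSym (Q' : ℤ) Q * (jacobiSym (Q' : ℤ) Q * jacobiSym (u : ℤ) Q) := by ring
    _ = jacobiSym (Q' : ℤ) Q := by rw [hprod, mul_one]

/-- The integer identity behind twist absorption: `(Q|Q') = (h|Q) · (hu₂|Q)` for distinct primes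
`Q ≡ Q' ≡ 1 (mod 4)`, `Q'u₂ ≡ 1 (mod Q)` and `gcd(h, Q) = 1` (multiplicativity, `(h|Q)² = 1`,
`(u₂|Q) = (Q'|Q)`, quadratic reciprocity). [folklore] -/
theorem jacobiSym_eq_mul_twist {h : ℤ} {Q Q' u₂ : ℕ} (hQ : Q.Prime) (hQ' : Q'.Prime)
    (hQ4 : Q % 4 = 1) (hQ'4 : Q' % 4 = 1) (hne : Q ≠ Q') (hu₂ : Q' * u₂ ≡ 1 [MOD Q])
    (hgcd : Int.gcd h Q = 1) :
    jacobiSym (Q : ℤ) Q' = jacobiSym h Q * jacobiSym (h * u₂) Q := by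
  rw [jacobiSym.mul_left, ← mul_assoc, ← pow_two, jacobiSym.sq_one hgcd, one_mul,
    jacobiSym_natCast_eq_of_mul_modEq_one hQ hQ' hne hu₂]
  exact jacobiSym.quadratic_reciprocity_one_mod_four hQ4 (Nat.odd_iff.mpr (by omega))

/-- **Stub A — twist absorption** (card `salie-twist-absorption`, registered sub-goal of
stmt-Parity-11583, line `Ideate4Sketch`): for distinct primes `Q ≡ Q' ≡ 1 (mod 4)`, inverses
`Q'u₂ ≡ 1 (mod Q)`, `Qu₁ ≡ 1 (mod Q')` and `gcd(h, Q) = 1`,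
`(Q|Q') · S(h, QQ') = (h|Q) · ((hu₂|Q) · S(hu₂, Q)) · S(hu₁, Q')` with
`S(h, q) = Σ_{ν mod q, ν² ≡ -1} e(hν/q)` (the skeleton's `rootWeylSum`, body expanded): the
Legendre kernel `(Q|Q')` is absorbed into a Salié-type local factor at the row prime `Q`.
Proof: `rootWeylSum_mul_of_coprime` (CRT) and `jacobiSym_eq_mul_twist`. [folklore] -/
theorem stub_twistAbsorption :
    ∀ (h : ℤ) (Q Q' u₁ u₂ : ℕ), Q.Prime → Q'.Prime → Q % 4 = 1 → Q' % 4 = 1 → Q ≠ Q' →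
      Q' * u₂ ≡ 1 [MOD Q] → Q * u₁ ≡ 1 [MOD Q'] → Int.gcd h Q = 1 →
        (jacobiSym (Q : ℤ) Q' : ℂ) * (∑ ν ∈ (Finset.range (Q * Q')).filter (fun ν : ℕ => Q * Q' ∣ ν ^ 2 + 1), Complex.exp (2 * Real.pi * Complex.I * (h : ℂ) * (ν : ℂ) / ((Q * Q' : ℕ) : ℂ))) =
          (jacobiSym h Q : ℂ) * ((jacobiSym (h * u₂) Q : ℂ) * (∑ ν ∈ (Finset.range Q).filter (fun ν : ℕ => Q ∣ ν ^ 2 + 1), Complex.exp (2 * Real.pi * Complex.I * ((h * u₂ : ℤ) : ℂ) * (ν : ℂ) / (Q : ℂ)))) *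
            (∑ ν ∈ (Finset.range Q').filter (fun ν : ℕ => Q' ∣ ν ^ 2 + 1), Complex.exp (2 * Real.pi * Complex.I * ((h * u₁ : ℤ) : ℂ) * (ν : ℂ) / (Q' : ℂ))) := by
  intro h Q Q' u₁ u₂ hQ hQ' hQ4 hQ'4 hne hu₂ hu₁ hgcd
  rw [rootWeylSum_mul_of_coprime h ((Nat.coprime_primes hQ hQ').mpr hne) hu₂ hu₁,
    jacobiSym_eq_mul_twist hQ hQ' hQ4 hQ'4 hne hu₂ hgcd, Int.cast_mul]
  ring

end Summit.Parity.BatemanHorn.Cruxes.SplitBlockJacobi.SalieTwistAbsorption
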